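import Summits.MatrixMultiplication.MatrixMultiplication.Theorems.AbelianSTPPCensusTAStatCDefs

/-!
# T_A certificate, third range `5667 … 6190` (static t*-indexed linear checker, free budget parameter): kernel evaluation, shape checks, volumes `4571 … 5129`

Cell mm-stpp (rung F-M1), threshold T_A = `τ = 2.371`; checker in `AbelianSTPPCensusTAStatCDefs.lean`, table in `AbelianSTPPCensusTAStatCData.lean`.
`decide` with kernel reduction (standard axioms; no `native_decide`), `Elab.async false`; consumed by `TAStatC.checkV_sound` / `TAStatC.domV_sound`
in the leaf `AbelianSTPPCensusLeafTA6190Closed.lean`.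
WHAT THIS IS NOT: arithmetic on shape lists only; no statement about STPP families or `ω`.
-/

set_option linter.dupNamespace false
set_option autoImplicit false
set_option Elab.async false

namespace Summit.MatrixMultiplication.MatrixMultiplication.Theorems.TAStatC

set_option maxHeartbeats 0 in
/-- Check chunk: every sorted candidate shape of the volumes `4571 … 4703` passes `checkShape` (43179 (shape, bucket) checks). [original] -/
theorem ck4571 : TAStatC.checkV 133 4571 = true := by decide +kernel

set_option maxHeartbeats 0 in
/-- Check chunk: every sorted candidate shape of the volumes `4704 … 4839` passes `checkShape` (43934 (shape, bucket) checks). [original] -/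
theorem ck4704 : TAStatC.checkV 136 4704 = true := by decide +kernel

set_option maxHeartbeats 0 in
/-- Check chunk: every sorted candidate shape of the volumes `4840 … 4979` passes `checkShape` (44761 (shape, bucket) checks). [original] -/
theorem ck4840 : TAStatC.checkV 140 4840 = true := by decide +kernel

set_option maxHeartbeats 0 in
/-- Check chunk: every sorted candidate shape of the volumes `4980 … 5129` passes `checkShape` (43803 (shape, bucket) checks). [original] -/
theorem ck4980 : TAStatC.checkV 150 4980 = true := by decide +kernel

end Summit.MatrixMultiplication.MatrixMultiplication.Theorems.TAStatC
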